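import Summits.QuantumFields.YangMills.Theorems.ColdStartUniversalityLatticeLangevinTranslationCovariance
import Summits.QuantumFields.YangMills.Theorems.ColdStartUniversalityUniformColdStartMixingIntegrand
import HarnessLib

/-!
# Route `ColdStartUniversality` (cruxes 27363 / 24810 / aside 24809): COLD-START LOOP-STRING EXPECTATIONS ARE TRANSLATION
# INVARIANT at every cut-off and every time — `E[∏_{C∈os} W̄_{C+a}(U_t)] = E[∏_{C∈os} W̄_C(U_t)]`

Helper file (seat `ym-line-csu-p1`, g14; `--supports stmt-QuantumFields-27363`).  The crux integrand in the cruxes' own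
currency: the product over a loop string `os` of unit-scale labels of the `K`-fold block-averaged loop variables
`F.avgObs 𝓔 K C`, read on a step-`K` link configuration through the bond dictionary.  Combining
`TranslationCovariance.integral_translate_coldStart` (the law of every cold-start SZZ solution is invariant under the fine
translations `U ↦ U ∘ τ_s`) with the tree's static covariance `T3Family.avgObs_translate` (relabelling a unit label by
`a ∈ T₁` = pulling the fine configuration back by `L^K a`, Bałaban (2.17)):

* `toField_compTranslate` — dictionary: `U ∘ τ_s` read as a level-0 field is `GaugeField.translate s` of the field read from `U`;
* ★ `integral_string_translate_coldStart` — for every cold-start solution (any space, any flat driver, any SZZ coupling),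
  every `K`, `t`, unit vector `a` and loop string `os`: `E[∏_{C∈os} avgObs K (C.translate a) (U_t)] = E[∏_{C∈os} avgObs K C (U_t)]`.

So the cold-start Cesàro means of K_A1 / K_A1|Γ / K_A2 depend on a loop string only through its translation class (as
the Gibbs side `expectAt K` does, `TorusScheme.expectAt_map_eq_of_translate`); in particular the basepoint average in the
valley coordinate of LINE 7 is, in cold-start expectation, a single Polyakov line.  THEOREMS ONLY, [folklore];
RECORD-rung R3 plumbing; no crux, rung or summit statement is proved here and the Yang–Mills mass gap is NOT proved.
-/

set_option autoImplicit false

noncomputable section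

namespace Summit.QuantumFields.YangMills.Theorems.ColdStartUniversality.TranslationCovariance

open MeasureTheory
open scoped NNReal
open Literature.MathematicalPhysics.QuantumFieldTheory
open Literature.MathematicalPhysics.QuantumLattice (fundamentalRep fundamentalLatticeRep continuous_fundamentalRep)
open Literature.MathematicalPhysics.QuantumFieldTheory.Balaban1983to89

variable (F : T3ContinuumYM3Torus.T3Family) (K : ℕ)

/-- **Dictionary**: the translated configuration `U ∘ τ_s`, read as a level-0 field of Bałaban's `K`-th lattice, is the tree's
`GaugeField.translate s` of the field read from `U`. [folklore] -/
theorem toField_compTranslate (s : Literature.MathematicalPhysics.QuantumFieldTheory.Site 3 ((F.P K).sitesPerDir 0))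
    (U : GaugeConfig 3 ((F.P K).sitesPerDir 0) (Matrix.specialUnitaryGroup (Fin 2) ℂ)) :
    (fun b : PBond (F.P K) 0 => (fun e : Edge 3 ((F.P K).sitesPerDir 0) => U (e.1 + s, e.2)) (b.src, b.dir)) =
      GaugeField.translate (P := F.P K) (j := 0) (s : Site (F.P K) 0)
        (fun b : PBond (F.P K) 0 => U (b.src, b.dir) : GaugeField (F.P K) 0 (Matrix.specialUnitaryGroup (Fin 2) ℂ)) := by
  funext b
  rfl

/-- ★ **COLD-START LOOP-STRING EXPECTATIONS ARE TRANSLATION INVARIANT.**  For every cold-start solution `U` of the step-`K`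
`SU(2)` lattice Langevin dynamics (any coupling `β'`, any probability space, any flat driver), every lattice time `t`, every
unit translation `a ∈ T₁` and every loop string `os`:
`E[∏_{C∈os} avgObs K (C + a) (U_t)] = E[∏_{C∈os} avgObs K C (U_t)]`. [cite: Balaban1987RG1, (2.17) p.269] -/
theorem integral_string_translate_coldStart (β' : ℝ) (a : F.USite) (os : List (T3ContinuumYM3Torus.ULoop3 F))
    {Ω : Type} {mΩ : MeasurableSpace Ω} {P : Measure Ω} [IsProbabilityMeasure P]
    {W : ℝ≥0 → Ω → (Edge 3 ((F.P K).sitesPerDir 0) × NoiseIdx 2 → ℝ)} (hW : IsFlatBrownian W P)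
    {U : ℝ≥0 → Ω → GaugeConfig 3 ((F.P K).sitesPerDir 0) (Matrix.specialUnitaryGroup (Fin 2) ℂ)}
    (hU0 : ∀ ω, U 0 ω = fun _ => 1)
    (hU : (latticeLangevinDynamics (fundamentalLatticeRep 2) β').IsSolution (fundamentalRep (Fin 2))
      hW.natFiltration P W U) (t : ℝ≥0) :
    ∫ ω, (os.map fun C => F.avgObs (ExpMeanLog.expMeanLogSU : LoopAverage (Matrix.specialUnitaryGroup (Fin 2) ℂ)) K
        (C.translate a) (fun b : PBond (F.P K) 0 => U t ω (b.src, b.dir))).prod ∂P =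
      ∫ ω, (os.map fun C => F.avgObs (ExpMeanLog.expMeanLogSU : LoopAverage (Matrix.specialUnitaryGroup (Fin 2) ℂ)) K C
        (fun b : PBond (F.P K) 0 => U t ω (b.src, b.dir))).prod ∂P := by
  -- the fine translation vector `L^K · a` (Bałaban's `Site (F.P K) 0` is the dynamics' `Site 3 (sitesPerDir 0)`)
  set s : Literature.MathematicalPhysics.QuantumFieldTheory.Site 3 ((F.P K).sitesPerDir 0) :=
    (Site.scaleTo K (F.toLevel K a) : Site (F.P K) 0) with hs
  -- the string observable and its measurability
  set g : GaugeConfig 3 ((F.P K).sitesPerDir 0) (Matrix.specialUnitaryGroup (Fin 2) ℂ) → ℝ := fun V =>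
    (os.map fun C => F.avgObs (ExpMeanLog.expMeanLogSU : LoopAverage (Matrix.specialUnitaryGroup (Fin 2) ℂ)) K C
      (fun b : PBond (F.P K) 0 => V (b.src, b.dir))).prod with hg
  have hm : ∀ K' C, Measurable ((F.scheme (ExpMeanLog.expMeanLogSU :
      LoopAverage (Matrix.specialUnitaryGroup (Fin 2) ℂ)) 1).obs K' C) := fun K' C =>
    F.measurable_avgObs (F.avgMeasurable_of_measurableE _ T4ApexTwoLevel.measurableE_expMeanLogSU) K' C
  have hΦ : Measurable fun V : GaugeConfig 3 ((F.P K).sitesPerDir 0) (Matrix.specialUnitaryGroup (Fin 2) ℂ) =>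
      (fun b : PBond (F.P K) 0 => V (b.src, b.dir) : GaugeField (F.P K) 0 (Matrix.specialUnitaryGroup (Fin 2) ℂ)) :=
    measurable_pi_lambda _ fun b => measurable_pi_apply _
  have hgm : Measurable g := (T4GenFunBounds.measurable_prodObs _ hm K os).comp hΦ
  -- static covariance, factor by factor: `avgObs K (C + a) (V) = avgObs K C (τ_s V)`
  have hstat : ∀ ω, (os.map fun C => F.avgObs (ExpMeanLog.expMeanLogSU : LoopAverage (Matrix.specialUnitaryGroup (Fin 2) ℂ)) K
      (C.translate a) (fun b : PBond (F.P K) 0 => U t ω (b.src, b.dir))).prod =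
      g (fun e : Edge 3 ((F.P K).sitesPerDir 0) => U t ω (e.1 + s, e.2)) := by
    intro ω
    simp only [hg]
    rw [toField_compTranslate F K s (U t ω)]
    congr 1
    refine List.map_congr_left fun C _ => ?_
    exact F.avgObs_translate _ K a C _
  simp_rw [hstat]
  exact integral_translate_coldStart β' s hW hU0 hU hgm t

end Summit.QuantumFields.YangMills.Theorems.ColdStartUniversality.TranslationCovariance

end
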